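import Summits.AtomisticToContinuum.Crystallization.Theses.ChessboardParticlePlanes

/-!
# Crux `ChessboardParticlePlanes.LjPlaneChessboard` (stmt-AtomisticToContinuum-6709), line `Sketch`,
# stub `layerCosets` — each occupied plane is a finite disjoint union of cosets of the horizontal
# periods

Layer bookkeeping for the mode expansion of the Lennard-Jones chessboard estimate.  Let `Q` be a
periodic configuration of `ℝ³` (motif `F`, periods `G`, point set `F + G`) and let `a, b ∈ G` be two
horizontal periods (`a 2 = b 2 = 0`) such that every horizontal period is an integer combination
`k a + l b` (the `ℤ`-basis of `Λ₀ = G ∩ {x₂ = 0}` supplied by `stub_horizontalBasis`).  Then for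
every height `t` the occupied plane `{x₂ = t} ∩ (F + G)` is the disjoint union of the `Λ₀`-cosets
`f + ℤa + ℤb` of at most `#F` representatives `f` of height `t` lying in `F + G`. [folklore]

PROOF.  For a motif point `m ∈ F` the periods `g ∈ G` with `(m + g) 2 = t` are either none or a
single `Λ₀`-coset (two of them differ by a horizontal period); choose one, `g_m`, whenever it exists,
and let the representatives be the points `m + g_m` over the motif points `m` admitting such a
period (an image of a sub-finset of the motif, whence at most `#F` of them).  Distinct motif points
give `Λ₀`-inequivalent representatives because motif points are pairwise inequivalent modulo `G`
(`PeriodicConfiguration.eq_of_sub_mem`), and a point `m + g` of height `t` equals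
`(m + g_m) + (g - g_m)` with `g - g_m` a horizontal period, i.e. an integer combination of `a, b`.
Conversely `f + k a + l b` is a point (`PeriodicConfiguration.add_mem_points`) of height `f 2 = t`.

No definition and no notation is introduced; the linear independence of `a, b` (part of the
registered signature) is not needed for this set-theoretic statement.
-/

noncomputable section

namespace Summit.AtomisticToContinuum.Crystallization.Theorems.ChessboardParticlePlanesLjPlaneChessboard

open Literature.MathematicalPhysics.StatisticalMechanics

section LayerCosets

variable {Q : PeriodicConfiguration 3} {a b : EuclideanSpace ℝ (Fin 3)}

/-- Integer combinations `k a + l b` of two periods are periods. [folklore] -/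
theorem layerCosets_comb_mem (ha : a ∈ Q.lattice) (hb : b ∈ Q.lattice) (k l : ℤ) :
    (k : ℝ) • a + (l : ℝ) • b ∈ Q.lattice := by
  rw [Int.cast_smul_eq_zsmul, Int.cast_smul_eq_zsmul]
  exact Q.lattice.add_mem (Q.lattice.smul_mem k ha) (Q.lattice.smul_mem l hb)

/-- Translating by an integer combination of two horizontal vectors does not change the height:
`(f + k a + l b) 2 = f 2` when `a 2 = b 2 = 0`. [folklore] -/
theorem layerCosets_height (ha2 : a 2 = 0) (hb2 : b 2 = 0) (f : EuclideanSpace ℝ (Fin 3))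
    (k l : ℤ) : (f + (k : ℝ) • a + (l : ℝ) • b) 2 = f 2 := by
  simp [ha2, hb2]

/-- **Choice of coset representatives.**  For every height `t` there is a map `rep` assigning to
each point `m` that can be moved to height `t` by a period a translate `rep m ∈ m + G` of height
`t`. [folklore] -/
theorem layerCosets_exists_rep (Q : PeriodicConfiguration 3) (t : ℝ) :
    ∃ rep : EuclideanSpace ℝ (Fin 3) → EuclideanSpace ℝ (Fin 3),
      ∀ m, (∃ g ∈ Q.lattice, (m + g) 2 = t) → rep m - m ∈ Q.lattice ∧ rep m 2 = t := by
  have hex : ∀ m : EuclideanSpace ℝ (Fin 3), ∃ r : EuclideanSpace ℝ (Fin 3),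
      (∃ g ∈ Q.lattice, (m + g) 2 = t) → r - m ∈ Q.lattice ∧ r 2 = t := by
    intro m
    by_cases hm : ∃ g ∈ Q.lattice, (m + g) 2 = t
    · obtain ⟨g, hg, hgt⟩ := hm
      exact ⟨m + g, fun _ => ⟨by rwa [add_sub_cancel_left], hgt⟩⟩
    · exact ⟨m, fun h => absurd h hm⟩
  choose rep hrep using hex
  exact ⟨rep, hrep⟩

end LayerCosets

/-- **Stub `layerCosets` — the occupied planes are finite disjoint unions of `Λ₀`-cosets.**  For a
periodic configuration `Q` of `ℝ³` and horizontal periods `a, b` generating all horizontal periods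
over `ℤ`, every occupied plane `{x₂ = t} ∩ Q.points` is the disjoint union of the cosets
`f + ℤa + ℤb` over a finite set `F` of at most `#motif` representatives `f ∈ Q.points` of height `t`,
pairwise inequivalent modulo `ℤa + ℤb`. [folklore] -/
theorem layerCosets :
    ∀ (Q : PeriodicConfiguration 3) (a b : EuclideanSpace ℝ (Fin 3)), a ∈ Q.lattice → b ∈ Q.lattice →
      a 2 = 0 → b 2 = 0 → LinearIndependent ℝ ![a, b] →
      (∀ g ∈ Q.lattice, g 2 = 0 → ∃ k l : ℤ, g = (k : ℝ) • a + (l : ℝ) • b) →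
      ∀ t : ℝ, ∃ F : Finset (EuclideanSpace ℝ (Fin 3)),
        F.card ≤ Q.motif.card ∧ (∀ f ∈ F, f 2 = t ∧ f ∈ Q.points) ∧
        (∀ f ∈ F, ∀ f' ∈ F, f ≠ f' → ∀ k l : ℤ, f' ≠ f + (k : ℝ) • a + (l : ℝ) • b) ∧
        ∀ y : EuclideanSpace ℝ (Fin 3),
          (y ∈ Q.points ∧ y 2 = t) ↔ ∃ f ∈ F, ∃ k l : ℤ, y = f + (k : ℝ) • a + (l : ℝ) • b := by
  classical
  intro Q a b ha hb ha2 hb2 _ hgen t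
  -- representatives `rep m = m + g_m` of height `t`, one for each motif point admitting one
  obtain ⟨rep, hrep⟩ := layerCosets_exists_rep Q t
  set S : Finset (EuclideanSpace ℝ (Fin 3)) :=
    Q.motif.filter (fun m => ∃ g ∈ Q.lattice, (m + g) 2 = t) with hS
  -- the representatives lie at height `t` and in the point set
  have hF : ∀ f ∈ S.image rep, f 2 = t ∧ f ∈ Q.points := by
    intro f hf
    obtain ⟨m, hm, rfl⟩ := Finset.mem_image.1 hf
    obtain ⟨hmm, hPm⟩ := Finset.mem_filter.1 hm
    obtain ⟨h1, h2⟩ := hrep m hPm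
    refine ⟨h2, ?_⟩
    have e : rep m = m + (rep m - m) := by abel
    rw [e]
    exact Q.add_mem_points (Q.mem_points_of_mem_motif hmm) h1
  refine ⟨S.image rep, Finset.card_image_le.trans (Finset.card_filter_le _ _), hF, ?_, ?_⟩
  · -- distinct representatives are inequivalent modulo `ℤa + ℤb`
    intro f hf f' hf' hne k l heq
    obtain ⟨m, hm, rfl⟩ := Finset.mem_image.1 hf
    obtain ⟨m', hm', rfl⟩ := Finset.mem_image.1 hf'
    obtain ⟨hmm, hPm⟩ := Finset.mem_filter.1 hm
    obtain ⟨hmm', hPm'⟩ := Finset.mem_filter.1 hm'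
    have hsub : m' - m = (rep m - m) - (rep m' - m') + ((k : ℝ) • a + (l : ℝ) • b) := by
      rw [heq]
      abel
    have hlat : m' - m ∈ Q.lattice := by
      rw [hsub]
      exact Q.lattice.add_mem (Q.lattice.sub_mem (hrep m hPm).1 (hrep m' hPm').1)
        (layerCosets_comb_mem ha hb k l)
    have hmm'eq : m' = m := Q.eq_of_sub_mem m' hmm' m hmm hlat
    exact hne (by rw [hmm'eq])
  · -- the plane `{x₂ = t} ∩ Q.points` is the union of the cosets of the representatives
    intro y
    constructor
    · rintro ⟨⟨m, hmm, g, hg, rfl⟩, hy2⟩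
      have hPm : ∃ g ∈ Q.lattice, (m + g) 2 = t := ⟨g, hg, hy2⟩
      refine ⟨rep m, Finset.mem_image_of_mem rep (Finset.mem_filter.2 ⟨hmm, hPm⟩), ?_⟩
      obtain ⟨h1, h2⟩ := hrep m hPm
      have hhor : g - (rep m - m) ∈ Q.lattice := Q.lattice.sub_mem hg h1
      have hhor2 : (g - (rep m - m)) 2 = 0 := by
        have hmg : (m + g) 2 = t := hy2
        simp only [PiLp.sub_apply, PiLp.add_apply] at hmg h2 ⊢
        linarith
      obtain ⟨k, l, hkl⟩ := hgen _ hhor hhor2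
      refine ⟨k, l, ?_⟩
      have e : m + g = rep m + (g - (rep m - m)) := by abel
      rw [e, hkl, add_assoc]
    · rintro ⟨f, hf, k, l, rfl⟩
      obtain ⟨hf2, hfp⟩ := hF f hf
      exact ⟨by rw [add_assoc]; exact Q.add_mem_points hfp (layerCosets_comb_mem ha hb k l),
        by rw [layerCosets_height ha2 hb2, hf2]⟩

end Summit.AtomisticToContinuum.Crystallization.Theorems.ChessboardParticlePlanesLjPlaneChessboard

end
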